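import Summits.BirchSwinnertonDyer.BirchSwinnertonDyer.Theorems.SignedLowerHalvesKobayashiLowerHalfLargeImageMuPart
import Summits.BirchSwinnertonDyer.BirchSwinnertonDyer.Theorems.SignedLowerHalvesKobayashiLowerHalfSemistableMuSplit
import Literature.NumberTheory.EllipticCurves.SupersingularIrreducibleProofs
import HarnessLib

/-!
# Route `SignedLowerHalves`, crux 3 `KobayashiLowerHalfLargeImage` (item stmt-BirchSwinnertonDyer-19001):
# at LARGE IMAGE the Eisenstein half `KobayashiLowerDivisibility W p ε` IS ITS RATIONAL PART, for EVERY sign —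
# (route-independent part: no Theses import; the crux readings are in `…LargeImageMuPartRationalCrux.lean`)
# (cell `bsd-ssimc`, width seat `bsd-line-slh-p1-w6` gen 0; `--supports 19001`; THEOREMS ONLY)

HONEST FRAMING.  The crux is OPEN and nothing here proves it; BSD is not proved by any of this.  CONDITIONAL on displayed
PUBLISHED named facts (`h12`, `h41`: Kobayashi Thm. 1.2 / 4.1; `h5`, `h3`: period comparisons; `hJ`: the joint `±`
Coleman–Kato package `Kobayashi2003.thm62_63_73_signedColemanKato_zetaJoint`) and, ONLY at `p ≥ 5`, on Conjecture B⁰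
(`TeichSpanGenAll`, OPEN, cell bsd-f3-mu).

## What is proved

slh-p2's μ-SPLIT (`MuSplit.kobayashiLowerDivisibility_iff_dvd_C_pow_mul_and_mu_le`, p ≠ 2, good, `E[p]` irreducible,
`h5`/`h3`): `KobayashiLowerDivisibility W p ε` ⟺ for every datum, `char X^ε = (g)` with the RATIONAL divisibility
`L_p^ε ∣ p^t·g` AND the μ-inequality `μ(L_p^ε) ≤ μ(g)`.  Part B of this seat's μ-part files
(`LargeImageMuPart.mu_charGen_eq_mu_kobayashiL`, p650610) proves `μ(g) = μ(L_p^ε)` for EVERY generator, EVERY sign, at an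
odd good supersingular prime with `ρ̄_{E,p}` ONTO.  Hence:

* §1 **`kobayashiLowerDivisibility_iff_rational`** — at `p` odd good, `a_p = 0`, `Surj W p`: for EVERY sign `ε`,
  `KobayashiLowerDivisibility W p ε` ⟺ «for every datum, `char X^ε = (g)` with `L_p^ε ∣ p^t·g` for some `t`» (a divisibility
  in `Λ ⊗ ℚ_p` — the raw output of any Euler-system / Eisenstein-congruence / finite-slope engine BEFORE a μ-argument).
  At `p = 3` modulo PUBLISHED facts only; at `p ≥ 5` modulo B⁰ as well.  No sign choice, no μ-hypothesis, no μ-conjecture.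
* §2 **`kobayashiLowerDivisibility_of_pInverted`** — the horocycle line's λ-part binder `LambdaLowerDivisibility W p ε`
  (`ι(p^m·g) = ϖ·ι(L^ε·h)`) ALONE gives `KobayashiLowerDivisibility W p ε`, for THAT sign (w2 g5's door
  `HorocycleMuDoor.kobayashiLowerDivisibility_of_pInverted_of_hasUnitContent` without its `hμ`).
* (§3, the crux readings BY NAME and the `stub_three` ⟺ rational calibration, live in the sibling file
  `…LargeImageMuPartRationalCrux.lean`, which imports the route file.)

READING for the LEAD: at every pair of the crux's class the μ-step of any Eisenstein-half proof is FREE (both signs); the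
open content is a statement in `Λ ⊗ ℚ_p` (zeros in the open disc with multiplicity), i.e. exactly what the
Beilinson–Flach / BSTW-type arguments deliver before their separate μ-step (slh-p2's S5 seam), and exactly the horocycle /
affinoid-eisenstein «λ-part».  CALIBRATION / SUPPORT ONLY (pen rule D34-4 (3)): never an input to a registered stub, a
`closes`, or a by-name close of item 19001.

References: [Kobayashi2003] Conjecture (p. 2), Thm. 1.2, Thm. 4.1, (7.21), proof of Thm. 7.4 (p. 13);
[GreenbergVatsal2000] p. 2 (1)–(2), p. 4, §3 Rem. 3.4; [Washington1997] §7.1, §13.2; [PollackWeston2011] Thm. 4.1 (1), Rem. 4.2;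
[Vaserstein1972SL2] Theorem; [Pollack2003] Conj. 6.3; [Serre1972] §1.11 Prop. 12.
-/

-- D-0017: single-problem summit, the namespace repeats the problem name by design.
set_option linter.dupNamespace false
set_option autoImplicit false

noncomputable section

open scoped Classical MatrixGroups ModularForm

open CongruenceSubgroup WeierstrassCurve Literature.NumberTheory.EllipticCurves
  Literature.NumberTheory.EllipticCurves.ModularForms
  Literature.NumberTheory.EllipticCurves.Kobayashi2003 Literature.NumberTheory.EllipticCurves.GreenbergVatsal2000
  Literature.NumberTheory.EllipticCurves.Rank1Residual ZpExtension
  Summit.BirchSwinnertonDyer.Rank1Residual.Supersingular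

namespace Summit.BirchSwinnertonDyer.BirchSwinnertonDyer.Theorems.LargeImageMuPartRational

open Summit.BirchSwinnertonDyer.Rank1Residual.X1.MuLambda (mu)
open Summit.BirchSwinnertonDyer.BirchSwinnertonDyer.Cruxes.AnalyticMuZeroX9.TeichSpan (TeichSpanGenAll)
open Summit.BirchSwinnertonDyer.BirchSwinnertonDyer.Theorems.LargeImageMuPart (mu_charGen_eq_mu_kobayashiL)
open Summit.BirchSwinnertonDyer.BirchSwinnertonDyer.Theorems.MuSplit
  (kobayashiLowerDivisibility_iff_dvd_C_pow_mul_and_mu_le kobayashiLowerDivisibility_of_dvd_C_pow_mul_of_mu_le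
    iota_eq_C_mul_iota_iff)

/-! ## §1 `KobayashiLowerDivisibility W p ε` ⟺ its rational part, for every sign, at large image -/

section Rational

variable {p : ℕ} [Fact p.Prime] {W : WeierstrassCurve ℚ} [W.IsElliptic] [W.IsGloballyMinimal]

/-- `E[p]` is irreducible at a good prime `p ≠ 2` with `a_p = 0` (Serre 1972 Prop. 12; tree theorem). [cite: Serre1972, §1.11 Prop. 12] -/
theorem hasIrreducibleModPGaloisRep_of_apZero (hp2 : p ≠ 2) (hgood : W.HasGoodReductionAtPrime p)
    (hap : W.frobeniusTrace p = 0) : W.HasIrreducibleModPGaloisRep p :=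
  hasIrreducibleModPGaloisRep_of_dvd_frobeniusTrace W p hp2
    (W.not_dvd_minimalDiscriminantInt_of_hasGoodReductionAtPrime' p hgood) (by rw [hap]; exact dvd_zero _)

/-- **At large image, Kobayashi's Eisenstein half IS its rational part — for EVERY sign.**  GRANTED the published named
facts `h12`, `h41`, `h5`, `h3`, `hJ` and Conjecture B⁰ (used ONLY when `p ≥ 5`): for `W/ℚ` globally minimal, `p` odd
good, `a_p = 0`, `ρ̄_{E,p}` onto, and ANY sign `ε`: `KobayashiLowerDivisibility W p ε` ⟺ for every admissible
`(κ, γ, f, ϖ, L⁺, L⁻, D)` there are a generator `g` of `char X^ε` and `t ∈ ℕ` with `L_p^ε ∣ p^t·g` (divisibility in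
`Λ ⊗ ℚ_p`).  Proof: slh-p2's μ-split + this seat's `μ(g) = μ(L_p^ε)` (sign-blind defect × μ-floor).
[cite: Kobayashi2003, Conjecture (Main Conjecture) (p. 2), proof of Thm. 7.4 (p. 13)] [cite: GreenbergVatsal2000, p. 4]
[cite: PollackWeston2011, Rem. 4.2] -/
theorem kobayashiLowerDivisibility_iff_rational
    (h12 : Kobayashi2003.thm12_signedSelmerDual_finite_torsion)
    (h41 : Kobayashi2003.thm41_signedCharIdeal_divisibility)
    (h5 : realPeriodRat_eq_unit_mul_plusPeriod) (h3 : realPeriodRat_eq_unit_mul_plusPeriod_three)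
    (hJ : Kobayashi2003.thm62_63_73_signedColemanKato_zetaJoint) (hB : TeichSpanGenAll)
    (hp2 : p ≠ 2) (hgood : W.HasGoodReductionAtPrime p) (hap : W.frobeniusTrace p = 0) (hs : Surj W p) (ε : ℤˣ) :
    KobayashiLowerDivisibility W p ε ↔
    ∀ (κ : ZpExtension ℚ p) (γ : Field.absoluteGaloisGroup ℚ),
      κ.IsCyclotomic → κ.IsTopGenerator γ → IsCyclotomicVariable p γ →
      ∀ [NeZero (W.conductorNorm ℤ)] (f : CuspForm (Gamma0 (W.conductorNorm ℤ)) 2),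
        IsNewformOf W f → ∀ (ϖ : ℚ), (ϖ : ℝ) * W.realPeriodRat = plusPeriod f →
      ∀ (Lplus Lminus : IwasawaAlgebra p), IsPollackPair f p Lplus Lminus →
      ∀ (D : SignedSelmerDualData W κ γ ε),
        ∃ (g : IwasawaAlgebra p) (t : ℕ), D.charIdeal = Ideal.span {g} ∧
          kobayashiL ε Lplus Lminus ∣ PowerSeries.C (p : ℤ_[p]) ^ t * g := by
  have hirr : W.HasIrreducibleModPGaloisRep p := hasIrreducibleModPGaloisRep_of_apZero hp2 hgood hap
  constructor
  · intro h κ γ hκ hγ hv _ f hf ϖ hϖ Lplus Lminus hPP D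
    obtain ⟨g, t, hchar, hdvd, -⟩ :=
      (kobayashiLowerDivisibility_iff_dvd_C_pow_mul_and_mu_le W p h5 h3 hp2 hgood hirr ε).mp h
        κ γ hκ hγ hv f hf ϖ hϖ Lplus Lminus hPP D
    exact ⟨g, t, hchar, hdvd⟩
  · intro h
    refine kobayashiLowerDivisibility_of_dvd_C_pow_mul_of_mu_le W p h5 h3 hp2 hgood hirr ε ?_
    intro κ γ hκ hγ hv _ f hf ϖ hϖ Lplus Lminus hPP D
    obtain ⟨g, t, hchar, hdvd⟩ := h κ γ hκ hγ hv f hf ϖ hϖ Lplus Lminus hPP D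
    obtain ⟨hmu, -⟩ :=
      mu_charGen_eq_mu_kobayashiL h12 h41 h5 h3 hJ hB hp2 hgood hap hs hκ hγ hv hf hPP ε D hchar
    exact ⟨g, t, hchar, hdvd, le_of_eq hmu.symm⟩

/-! ## §2 The horocycle line's `p`-inverted binder alone gives the Eisenstein half, for its own sign -/

/-- **The `p`-INVERTED Eisenstein divisibility for a sign `ε` IS `KobayashiLowerDivisibility W p ε` at large image.**
Same named facts and B⁰ (only `p ≥ 5`); `p` odd good, `a_p = 0`, `ρ̄_{E,p}` onto.  Hypothesis `hlam` = the body of line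
`horocycle_mu_floor`'s `LambdaLowerDivisibility W p ε` VERBATIM (`char X^ε = (g)`, `ι(p^m·g) = ϖ·ι(L^ε·h)`).  Compared with
w2 g5's door `HorocycleMuDoor.kobayashiLowerDivisibility_of_pInverted_of_hasUnitContent`, the hypothesis `μ(L_p^ε) = 0` is
GONE (it is not needed for either sign: the μ-inequality holds with equality by the sign-blind defect).
[cite: Kobayashi2003, Conjecture (Main Conjecture) (p. 2)] [cite: GreenbergVatsal2000, §3 Remark 3.4, p. 4] -/
theorem kobayashiLowerDivisibility_of_pInverted
    (h12 : Kobayashi2003.thm12_signedSelmerDual_finite_torsion)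
    (h41 : Kobayashi2003.thm41_signedCharIdeal_divisibility)
    (h5 : realPeriodRat_eq_unit_mul_plusPeriod) (h3 : realPeriodRat_eq_unit_mul_plusPeriod_three)
    (hJ : Kobayashi2003.thm62_63_73_signedColemanKato_zetaJoint) (hB : TeichSpanGenAll)
    (hp2 : p ≠ 2) (hgood : W.HasGoodReductionAtPrime p) (hap : W.frobeniusTrace p = 0) (hs : Surj W p) (ε : ℤˣ)
    (hlam : ∀ (κ : ZpExtension ℚ p) (γ : Field.absoluteGaloisGroup ℚ),
        κ.IsCyclotomic → κ.IsTopGenerator γ → IsCyclotomicVariable p γ →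
      ∀ [NeZero (W.conductorNorm ℤ)] (f : CuspForm (Gamma0 (W.conductorNorm ℤ)) 2),
        IsNewformOf W f → ∀ (ϖ : ℚ), (ϖ : ℝ) * W.realPeriodRat = plusPeriod f →
      ∀ (Lplus Lminus : IwasawaAlgebra p), IsPollackPair f p Lplus Lminus →
      ∀ (D : SignedSelmerDualData W κ γ ε),
        ∃ (g h : IwasawaAlgebra p) (m : ℕ), D.charIdeal = Ideal.span {g} ∧
          iwasawaToPowerSeries p (PowerSeries.C ((p : ℤ_[p]) ^ m) * g) =
            PowerSeries.C (ϖ : ℚ_[p]) * iwasawaToPowerSeries p (kobayashiL ε Lplus Lminus * h)) :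
    KobayashiLowerDivisibility W p ε := by
  have hirr : W.HasIrreducibleModPGaloisRep p := hasIrreducibleModPGaloisRep_of_apZero hp2 hgood hap
  refine (kobayashiLowerDivisibility_iff_rational h12 h41 h5 h3 hJ hB hp2 hgood hap hs ε).mpr ?_
  intro κ γ hκ hγ hv _ f hf ϖ hϖ Lplus Lminus hPP D
  obtain ⟨g, h, m, hchar, hι⟩ := hlam κ γ hκ hγ hv f hf ϖ hϖ Lplus Lminus hPP D
  have hϖ0 : ϖ ≠ 0 := hf.periodRatio_ne_zero hϖ
  have hvϖ : padicValRat p ϖ = 0 := padicValRat_periodRatio_eq_zero h5 h3 W p hp2 hgood hirr f hf ϖ hϖ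
  obtain ⟨u, hu⟩ := exists_units_coe_eq_ratCast hϖ0 hvϖ
  have heq : PowerSeries.C ((p : ℤ_[p]) ^ m) * g =
      PowerSeries.C (u : ℤ_[p]) * (kobayashiL ε Lplus Lminus * h) :=
    (iota_eq_C_mul_iota_iff u hu _ _).mp hι
  refine ⟨g, m, hchar, ⟨PowerSeries.C (u : ℤ_[p]) * h, ?_⟩⟩
  rw [← map_pow, heq]
  ring

end Rational

end Summit.BirchSwinnertonDyer.BirchSwinnertonDyer.Theorems.LargeImageMuPartRational

end
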